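import Summits.BirchSwinnertonDyer.BirchSwinnertonDyer.Theorems.PrintCFramBottomClassIndexLawFiveLeKrizLiBindersTwistedBlock
import HarnessLib

/-!
# Crux `PrintCFram.BottomClassIndexLawFiveLe` (stmt-BirchSwinnertonDyer-20372), line `eisenstein-resource-bdp-line` (registry v10/v11):
# the twisted-member ENGINE of the Kriz–Li character ∧ `ε_K` ∧ Bernoulli-(4) block for an EVEN-TYPE twisting discriminant
# (`e ≡ 2, 3 (mod 4)`, class character mod `4|e|`) and an odd squarefree `|d_K|`
# (cell `bsd-print-cfram`, width seat `bsd-line-cfram-p1-w5` g0; THEOREMS ONLY, `--supports` 20372; BSD is not proved by any of this)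

HONEST FRAMING. Nothing here proves BSD or closes a stub. w3 g3's `krizLi_characterBernoulliBlock_twist_odd` (and this seat's
squarefree-`q` copy `…_sqfree`) assemble the block `(f ψ ω εK ∣ hψ hω hss h1 h1' h3 h4)` of the composition's Kriz–Li branch at a twisted
member with `e ≡ 1 (mod 4)`. Thirteen census rows of the `≥ 5` window have an EVEN-TYPE twisting discriminant (`e ∈ {2, 3, 6, 7, 10, 14, 15}`,
class character of conductor `4|e|`): `7744a1, 69696fh1, 94864bt1, 193600gy1, 379456fy1, 435600kh1` (p = 11), `23104a1, 51984cc1, 207936v1,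
283024bq1` (19), `118336a1, 266256bp1` (43), `287296h1` (67). THIS FILE is the even-type engine: same proof as the odd one with w3 g2's
`krizLiBinders_of_coprime_twist_even` / `exists_kroneckerFourPadic` / `isPrimitive_of_forall_eq_kroneckerFour'` in place of the Jacobi
character mod `|e|`, and the `K''`-character built as `χ↑·κ↑` mod `4|e|·q` (`κ(a) = J(a | q)`, values multiply unit-by-unit, both vanish off
units):

* `krizLi_characterBernoulliBlock_twist_even_sqfree`.

Consumers: `…KrizLi4BlocksC*.lean` (this seat). beyond-print theorem: NO.
References: [KrizLi2019] Thm. 1.20 (pp. 7–8), Rem. 1.21, §1.5, §2, §7.1; [Washington1997] §5.1, Thm. 4.2; [Cox2013] §1.C Lemma 1.14.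
-/

set_option autoImplicit false
set_option linter.dupNamespace false

noncomputable section

open scoped Classical

namespace Summit.BirchSwinnertonDyer.BirchSwinnertonDyer.Theorems.PrintCFram.KrizLiBindersTwisted

open scoped NumberTheorySymbols
open WeierstrassCurve IsDedekindDomain NumberField DirichletCharacter Literature.NumberTheory.LFunctions
  Literature.NumberTheory.EllipticCurves Literature.NumberTheory.EllipticCurves.ModularForms
  Literature.NumberTheory.EllipticCurves.Rank1Residual Literature.NumberTheory.EllipticCurves.KrizLi2019
  Summit.BirchSwinnertonDyer.Rank1Residual Summit.BirchSwinnertonDyer.Rank1Residual.X12.O11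
  Summit.BirchSwinnertonDyer.BirchSwinnertonDyer.Theorems.PrintCFram.OffLocus

variable {p : ℕ} [hp : Fact p.Prime]

set_option maxHeartbeats 800000 in
/-- **THE CHARACTER ∧ BERNOULLI BLOCK AT A TWISTED MEMBER WITH AN EVEN-TYPE TWISTING DISCRIMINANT (`e ≡ 2, 3 (mod 4)`), FROM TWO
CERTIFICATES.** The even-type twin of w3 g3's `krizLi_characterBernoulliBlock_twist_odd`: the class character is `χ` mod `4|e|` with values
`[a odd]·J(e | a)` (w3 g2's `KrizLiBinders.krizLiBinders_of_coprime_twist_even`, `exists_kroneckerFourPadic`, `isPrimitive_of_forall_eq_kroneckerFour'`),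
`ψ := χ↑·(ω^k)↑` at level `p·4|e|`; `|d_K| = q` odd squarefree coprime to `p` and to `4|e|`, `ε_K(a) = J(a | q)`. From the UNIT certificates
`‖B_{1,θ₁}‖ = 1` for every `θ₁` mod `p·4|e|` with values `[j odd]J(e | j)·ω(j)^{p−1−k}` (class factor `ψ⁻¹`) and `‖B_{1,θ₂}‖ = 1` for every
`θ₂` mod `p·4|e|·q` with values `[j odd]J(e | j)·J(j | q)·ω(j)^{k−1}` (`K''`-factor `ψε_Kω⁻¹`): `ψ` is PRIMITIVE, ODD (`hpar`), has `hss`, (1),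
(3) for `W`, and Kriz–Li's (4) holds. The `K''`-character `χ₂ = χ↑·κ↑` mod `4|e|·q` (`κ(a) = J(a | q)`) is primitive of conductor `4|e|·q`
(`RouteU.conductor_changeLevel_mul_changeLevel`). ODD-TYPE DOCSTRING (for comparison): `p` odd; `E/ℚ` good away from `p` with trace
form `a_ℓ(E) ≡ ℓ^k + ℓ^{p−k}` (`2 ≤ k ≤ p−2`); `W ∼ W₁ ≅ E^{(e)}` with `e ≡ 1 (mod 4)` squarefree, `p ∤ e`; `χ` the `ℚ_p`-valued Jacobi
character mod `|e|` with `χ(−1)·(−1)^k = −1` (so `ψ = χ·ω^k` is odd); `ω` Teichmüller; `q ∤ 2pe` an odd prime and `εK` with values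
`(·/q)`. From the UNIT certificates `‖B_{1,θ₁}‖ = 1` for `θ₁(j) = (j/|e|)·ω(j)^{p−1−k}` mod `p|e|` (class factor `ψ⁻¹`) and
`‖B_{1,θ₂}‖ = 1` for `θ₂(j) = (j/|e|q)·ω(j)^{k−1}` mod `p|e|q` (`K''`-factor `ψε_Kω⁻¹`): `ψ` is PRIMITIVE, ODD, has `hss`, (1), (3)
for `W`, and Kriz–Li's (4) `¬ ‖B_{1,ψ₀⁻¹ε_K}·B_{1,ψ₀ω⁻¹}‖ ≤ p⁻¹` holds. (w3 g2's `AnchorBase.krizLi_characterBernoulliBlock_base` is the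
case `e = 1`.) [cite: KrizLi2019, Thm. 1.20 (pp. 7–8), Rem. 1.21, §1.5, §2, §7.1] [cite: Washington1997, §5.1, Thm. 4.2] -/
theorem krizLi_characterBernoulliBlock_twist_even_sqfree (hp2 : p ≠ 2) (E : WeierstrassCurve ℚ) [E.IsElliptic] {k : ℕ}
    (hk2 : 2 ≤ k) (hkp : k ≤ p - 2)
    (hgood : ∀ (r : ℕ) [Fact r.Prime], r ≠ p → E.HasGoodReductionAtPrime r)
    (hbase : ∀ (ℓ : ℕ) [Fact ℓ.Prime], ℓ ≠ p → (E.LFunction ℓ : ZMod p) = (ℓ : ZMod p) ^ k + (ℓ : ZMod p) ^ (p - k))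
    (W W₁ : WeierstrassCurve ℚ) [W.IsElliptic] [W₁.IsElliptic] (hiso : IsIsogenous W W₁)
    {e : ℤ} (he4 : e % 4 = 2 ∨ e % 4 = 3) (hsq : Squarefree e) (hpe : ¬ (p : ℤ) ∣ e)
    (hW₁ : ∃ C : VariableChange ℚ, C • W₁ = E.quadraticTwist (e : ℚ)) [NeZero (4 * e.natAbs)]
    (χ : DirichletCharacter ℚ_[p] (4 * e.natAbs))
    (hχ : ∀ a : ℕ, χ (a : ZMod (4 * e.natAbs)) = ((if Even a then (0 : ℤ) else J(e | a) : ℤ) : ℚ_[p]))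
    (hpar : χ (-1) * (-1) ^ k = -1)
    (ω : DirichletCharacter ℚ_[p] p) (hω : IsTeichmullerCharacter ω)
    {q : ℕ} [NeZero q] (hqodd : Odd q) (hqsq : Squarefree q) (hqp : q.Coprime p) (hqm : q.Coprime (4 * e.natAbs))
    {d : ℕ} (hd : d = q) [NeZero d]
    (εK : DirichletCharacter ℚ_[p] d) (hεK : ∀ a : ℕ, εK (a : ZMod d) = (J((a : ℤ) | q) : ℚ_[p]))
    (hcert₁ : ∀ θ₁ : DirichletCharacter ℚ_[p] (p * (4 * e.natAbs)),
      (∀ j : ZMod (p * (4 * e.natAbs)),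
        θ₁ j = ((if Even j.val then (0 : ℤ) else J(e | j.val) : ℤ) : ℚ_[p]) * ω (j.val : ZMod p) ^ (p - 1 - k)) →
      ‖generalizedBernoulli 1 θ₁‖ = 1)
    (hcert₂ : ∀ θ₂ : DirichletCharacter ℚ_[p] (p * (4 * e.natAbs * q)),
      (∀ j : ZMod (p * (4 * e.natAbs * q)),
        θ₂ j = ((if Even j.val then (0 : ℤ) else J(e | j.val) : ℤ) : ℚ_[p]) * (J((j.val : ℤ) | q) : ℚ_[p]) *
          ω (j.val : ZMod p) ^ (k - 1)) →
      ‖generalizedBernoulli 1 θ₂‖ = 1) :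
    ∃ (f : ℕ) (_ : NeZero f) (ψ : DirichletCharacter ℚ_[p] f),
      ψ.IsPrimitive ∧ ψ.Odd ∧
      (∀ ℓ : ℕ, ℓ.Prime → ¬ (ℓ ∣ p * W.conductorNorm ℤ) →
        ‖((W.LFunction ℓ : ℤ) : ℚ_[p]) - (ψ (ℓ : ZMod f) + ψ⁻¹ (ℓ : ZMod f) * ω (ℓ : ZMod p))‖ < 1) ∧
      (ψ (p : ZMod f) ≠ 1 ∧ primVal (invMulOmega ψ ω) p ≠ 1) ∧
      (∀ ℓ : ℕ, (hℓ : ℓ.Prime) → ℓ ≠ p →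
        (haveI := Fact.mk hℓ; ¬ W.HasGoodReductionAtPrime ℓ ∧ ¬ W.HasMultiplicativeReductionAtPrime ℓ) →
        ψ (ℓ : ZMod f) ≠ 1 ∧ primVal (invMulOmega ψ ω) ℓ ≠ 1) ∧
      ¬ (‖bernoulliOnePrim (bernoulliCharOne ψ εK) * bernoulliOnePrim (bernoulliCharTwo ψ εK ω)‖ ≤ (p : ℝ)⁻¹) := by
  have hd' := hd.symm
  subst hd'
  have hpp : p.Prime := hp.out
  have he0 : e ≠ 0 := hsq.ne_zero
  have hm0 : (4 * e.natAbs) ≠ 0 := NeZero.ne (4 * e.natAbs)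
  have hpe' : ¬ p ∣ e.natAbs := fun h => hpe (Int.natCast_dvd.mpr h)
  have hp4 : ¬ p ∣ 4 := fun h => hp2 ((Nat.prime_dvd_prime_iff_eq hpp Nat.prime_two).mp
    (hpp.dvd_of_dvd_pow (show p ∣ 2 ^ 2 by norm_num; exact h)))
  have hpm : ¬ p ∣ (4 * e.natAbs) := fun h => by
    rcases (Nat.Prime.dvd_mul hpp).mp h with h4 | he
    · exact hp4 h4
    · exact hpe' he
  have hmp : (4 * e.natAbs).Coprime p := ((Nat.Prime.coprime_iff_not_dvd hpp).mpr hpm).symm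
  have hq0 : q ≠ 0 := hqsq.ne_zero
  have hmq : (4 * e.natAbs).Coprime q := hqm.symm
  haveI : NeZero (p * (4 * e.natAbs)) := ⟨Nat.mul_ne_zero hpp.ne_zero hm0⟩
  haveI : NeZero ((4 * e.natAbs) * q) := ⟨Nat.mul_ne_zero hm0 hq0⟩
  haveI : NeZero (p * ((4 * e.natAbs) * q)) := ⟨Nat.mul_ne_zero hpp.ne_zero (NeZero.ne _)⟩
  -- the engine (w3 g2, part M, even twisting discriminant)
  obtain ⟨hprim, hss, h1, h3⟩ := KrizLiBinders.krizLiBinders_of_coprime_twist_even (p := p) hp2 E hk2 hkp hgood hbase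
    W W₁ hiso he4 hsq hpe hW₁ χ hχ ω hω
  set ψ : DirichletCharacter ℚ_[p] (p * (4 * e.natAbs)) :=
    changeLevel (dvd_mul_left (4 * e.natAbs) p) χ * changeLevel (dvd_mul_right p (4 * e.natAbs)) (ω ^ k) with hψdef
  have hodd : ψ.Odd := by
    rw [hψdef]; exact KrizLiBinders.psi_odd_of ω χ k hp2 hω (by omega) hpar
  have hnev : ¬ ψ.Even := EisensteinPair.not_even_of_odd' ψ hodd
  refine ⟨p * (4 * e.natAbs), inferInstance, ψ, hprim, hodd, hss, h1, h3, ?_⟩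
  -- χ is primitive quadratic
  have hχprim : χ.IsPrimitive := KrizLiBinders.isPrimitive_of_forall_eq_kroneckerFour' (m := e) rfl he4 hsq hχ
  have hχq : χ⁻¹ = χ := MulChar.IsQuadratic.inv (KrizLiBinders.isQuadratic_of_forall_eq_kroneckerFour hχ)
  -- θ₁ = ψ⁻¹ = χ↑·(ω^{p−1−k})↑
  set θ₁ : DirichletCharacter ℚ_[p] (p * (4 * e.natAbs)) :=
    changeLevel (dvd_mul_left (4 * e.natAbs) p) χ * changeLevel (dvd_mul_right p (4 * e.natAbs)) (ω ^ (p - 1 - k)) with hθ₁def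
  have hψinv : ψ⁻¹ = θ₁ := by
    rw [hψdef, hθ₁def, mul_inv, ← map_inv, ← map_inv, hχq, KrizLiBinders.char_pow_inv_eq ω (by omega)]
  have hθ₁prim : θ₁.IsPrimitive :=
    KrizLiBinders.psi_isPrimitive ω χ (p - 1 - k) hmp hχprim (KrizLiBinders.teichmuller_pow_ne_one hω (by omega) (by omega))
  have hθ₁val : ∀ j : ZMod (p * (4 * e.natAbs)),
      θ₁ j = ((if Even j.val then (0 : ℤ) else J(e | j.val) : ℤ) : ℚ_[p]) * ω (j.val : ZMod p) ^ (p - 1 - k) := by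
    intro j
    rw [hθ₁def, changeLevel_mul_apply_eq (p := p) χ (ω ^ (p - 1 - k)) j, hχ j.val, MulChar.pow_apply' _ (by omega)]
  have hu₁ : ‖generalizedBernoulli 1 θ₁‖ = 1 := hcert₁ θ₁ hθ₁val
  have h₁ : p * (4 * e.natAbs) ∣ p * (4 * e.natAbs) * q := dvd_mul_right _ q
  have hχ₁ : bernoulliCharOne ψ εK = changeLevel h₁ θ₁ := by
    rw [RegularLocusBernoulliPair.bernoulliCharOne_of_not_even ψ εK hnev, hψinv]
  -- χ₂ := χ↑·κ↑ mod (4 * e.natAbs)·q with κ the Jacobi character mod q; values χ(a)·J(a | q)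
  obtain ⟨κ, hκ⟩ := KrizLiBinders.exists_jacobiCharPadic (p := p) q
  have hκprim : κ.IsPrimitive := KrizLiBinders.isPrimitive_of_forall_eq_jacobiSym hκ hqodd hqsq
  set χ₂ : DirichletCharacter ℚ_[p] ((4 * e.natAbs) * q) :=
    changeLevel (dvd_mul_right (4 * e.natAbs) q) χ * changeLevel (dvd_mul_left q (4 * e.natAbs)) κ with hχ₂def
  have hχ₂prim : χ₂.IsPrimitive := by
    have hcχ : χ.conductor = (4 * e.natAbs) := hχprim
    have hcκ : κ.conductor = q := hκprim
    rw [isPrimitive_def, hχ₂def, RouteU.conductor_changeLevel_mul_changeLevel _ _ χ κ (by rw [hcχ, hcκ]; exact hmq),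
      hcχ, hcκ]
  have hχ₂val : ∀ a : ℕ, χ₂ (a : ZMod ((4 * e.natAbs) * q)) = χ (a : ZMod (4 * e.natAbs)) * κ (a : ZMod q) := by
    intro a
    by_cases hu : IsUnit ((a : ℕ) : ZMod ((4 * e.natAbs) * q))
    · have hcop : a.Coprime ((4 * e.natAbs) * q) := (ZMod.isUnit_iff_coprime a ((4 * e.natAbs) * q)).mp hu
      have hcopZ : IsCoprime ((a : ℕ) : ℤ) (((4 * e.natAbs) * q : ℕ) : ℤ) := Nat.isCoprime_iff_coprime.mpr hcop
      have e1 := changeLevel_eq_cast_of_dvd' χ (dvd_mul_right (4 * e.natAbs) q) hcopZ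
      have e2 := changeLevel_eq_cast_of_dvd' κ (dvd_mul_left q (4 * e.natAbs)) hcopZ
      simp only [Int.cast_natCast] at e1 e2
      rw [hχ₂def, MulChar.mul_apply, e1, e2]
    · rw [MulChar.map_nonunit _ hu]
      have hncop : ¬ a.Coprime ((4 * e.natAbs) * q) := fun h => hu ((ZMod.isUnit_iff_coprime a ((4 * e.natAbs) * q)).mpr h)
      by_cases ham : a.Coprime (4 * e.natAbs)
      · have haq : ¬ a.Coprime q := fun h => hncop (Nat.Coprime.mul_right ham h)
        have : ¬ IsUnit ((a : ℕ) : ZMod q) := fun h => haq ((ZMod.isUnit_iff_coprime a q).mp h)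
        rw [MulChar.map_nonunit _ this, mul_zero]
      · have : ¬ IsUnit ((a : ℕ) : ZMod (4 * e.natAbs)) := fun h => ham ((ZMod.isUnit_iff_coprime a (4 * e.natAbs)).mp h)
        rw [MulChar.map_nonunit _ this, zero_mul]
  -- θ₂ = χ₂↑·(ω^{k−1})↑
  set θ₂ : DirichletCharacter ℚ_[p] (p * ((4 * e.natAbs) * q)) :=
    changeLevel (dvd_mul_left ((4 * e.natAbs) * q) p) χ₂ * changeLevel (dvd_mul_right p ((4 * e.natAbs) * q)) (ω ^ (k - 1)) with hθ₂def
  have hθ₂prim : θ₂.IsPrimitive :=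
    KrizLiBinders.psi_isPrimitive ω χ₂ (k - 1) (Nat.Coprime.mul_left hmp hqp) hχ₂prim
      (KrizLiBinders.teichmuller_pow_ne_one hω (by omega) (by omega))
  have hθ₂val : ∀ j : ZMod (p * ((4 * e.natAbs) * q)),
      θ₂ j = ((if Even j.val then (0 : ℤ) else J(e | j.val) : ℤ) : ℚ_[p]) * (J((j.val : ℤ) | q) : ℚ_[p]) *
        ω (j.val : ZMod p) ^ (k - 1) := by
    intro j
    rw [hθ₂def, changeLevel_mul_apply_eq (p := p) χ₂ (ω ^ (k - 1)) j, hχ₂val j.val, hχ j.val, hκ j.val,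
      MulChar.pow_apply' _ (by omega)]
  have hu₂ : ‖generalizedBernoulli 1 θ₂‖ = 1 := hcert₂ θ₂ hθ₂val
  -- identification of `ψ₀ω⁻¹` with the lift of `θ₂`
  have h₂ : p * ((4 * e.natAbs) * q) ∣ p * (4 * e.natAbs) * q * p := ⟨p, by ring⟩
  have hχ₂eq : bernoulliCharTwo ψ εK ω = changeLevel h₂ θ₂ := by
    haveI : NeZero (p * (4 * e.natAbs) * q * p) := ⟨Nat.mul_ne_zero (Nat.mul_ne_zero (NeZero.ne _) hq0) hpp.ne_zero⟩
    rw [RegularLocusBernoulliPair.bernoulliCharTwo_of_not_even ψ εK ω hnev]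
    refine MulChar.ext fun u => ?_
    have hcop : ((u : ZMod (p * (4 * e.natAbs) * q * p)).val).Coprime (p * (4 * e.natAbs) * q * p) := ZMod.val_coe_unit_coprime u
    have ea : ((u : ZMod (p * (4 * e.natAbs) * q * p)) : ZMod (p * (4 * e.natAbs) * q * p)) =
        ((((u : ZMod (p * (4 * e.natAbs) * q * p)).val : ℕ) : ℤ) : ZMod (p * (4 * e.natAbs) * q * p)) := by
      rw [Int.cast_natCast, ZMod.natCast_zmod_val]
    set a : ℕ := (u : ZMod (p * (4 * e.natAbs) * q * p)).val with ha
    have cL : IsCoprime (a : ℤ) ((p * (4 * e.natAbs) * q * p : ℕ) : ℤ) := Nat.isCoprime_iff_coprime.mpr hcop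
    have cpmq : IsCoprime (a : ℤ) ((p * (4 * e.natAbs) * q : ℕ) : ℤ) :=
      Nat.isCoprime_iff_coprime.mpr (hcop.coprime_dvd_right (Dvd.intro p rfl))
    have cpm : IsCoprime (a : ℤ) ((p * (4 * e.natAbs) : ℕ) : ℤ) :=
      Nat.isCoprime_iff_coprime.mpr (hcop.coprime_dvd_right (Dvd.intro (q * p) (by ring)))
    have cpmq' : IsCoprime (a : ℤ) ((p * ((4 * e.natAbs) * q) : ℕ) : ℤ) :=
      Nat.isCoprime_iff_coprime.mpr (hcop.coprime_dvd_right ⟨p, by ring⟩)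
    have cmq : IsCoprime (a : ℤ) (((4 * e.natAbs) * q : ℕ) : ℤ) :=
      Nat.isCoprime_iff_coprime.mpr (hcop.coprime_dvd_right ⟨p * p, by ring⟩)
    have cap : a.Coprime p := hcop.coprime_dvd_right (Dvd.intro ((4 * e.natAbs) * q * p) (by ring))
    have hpa : ¬ ((p : ℤ) ∣ (a : ℤ)) := by
      rw [Int.natCast_dvd_natCast]; exact fun h => hpp.one_lt.ne' (Nat.Coprime.eq_one_of_dvd cap.symm h) |>.elim
    have ha2 : ¬ Even a := by
      intro hev
      have h4 : a.Coprime 4 := hcop.coprime_dvd_right ⟨p * e.natAbs * q * p, by ring⟩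
      have h2 : a.Coprime 2 := h4.coprime_dvd_right ⟨2, by norm_num⟩
      exact (Nat.not_even_iff_odd.mpr (Nat.coprime_two_right.mp h2)) hev
    rw [ea, MulChar.mul_apply, changeLevel_eq_cast_of_dvd' _ _ cL, changeLevel_eq_cast_of_dvd' _ _ cL, MulChar.mul_apply,
      changeLevel_eq_cast_of_dvd' _ _ cpmq, changeLevel_eq_cast_of_dvd' _ _ cpmq, hψdef, MulChar.mul_apply,
      changeLevel_eq_cast_of_dvd' _ _ cpm, changeLevel_eq_cast_of_dvd' _ _ cpm,
      changeLevel_eq_cast_of_dvd' _ _ cL, hθ₂def, MulChar.mul_apply,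
      changeLevel_eq_cast_of_dvd' _ _ cpmq', changeLevel_eq_cast_of_dvd' _ _ cpmq', hχ₂def, MulChar.mul_apply,
      changeLevel_eq_cast_of_dvd' _ _ cmq, changeLevel_eq_cast_of_dvd' _ _ cmq]
    simp only [Int.cast_natCast]
    rw [hχ a, hεK a, hκ a, if_neg ha2, MulChar.pow_apply' _ (by omega : k ≠ 0), MulChar.pow_apply' _ (by omega : k - 1 ≠ 0),
      MulChar.inv_apply_eq_inv']
    have hω0 : ω (a : ZMod p) ≠ 0 := by
      have h1 := norm_apply_eq_one ω (a : ℤ) hpa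
      intro h0; rw [Int.cast_natCast] at h1; rw [h0, norm_zero] at h1; exact zero_ne_one h1
    have hk1 : k = (k - 1) + 1 := by omega
    rw [hk1, pow_succ, Nat.add_sub_cancel]
    field_simp
  exact RouteU.bernoulli_hypothesis_of_certs θ₁ hθ₁prim h₁ θ₂ hθ₂prim h₂ _ hχ₁ _ hχ₂eq hu₁ hu₂


end Summit.BirchSwinnertonDyer.BirchSwinnertonDyer.Theorems.PrintCFram.KrizLiBindersTwisted

end
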